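import Summits.SmoothPoincare4.SmoothPoincare4.Theorems.ShadowsStandard.Negative.ShadowLevels
import Summits.SmoothPoincare4.SmoothPoincare4.Theorems.CongruenceShadowsHeegaardHandlebodyCongruenceClosedLocus
import Summits.SmoothPoincare4.SmoothPoincare4.Theorems.CongruenceShadowsShadowsStandardHelperGateOfMonodromy
import HarnessLib

/-!
# `TopGate` from alternating monodromy — helper `helper_topGateOfMonodromy` of line `prym-layer-stable-rank`
for crux `CongruenceShadows.ShadowsStandard` (item stmt-SmoothPoincare4-14593, route route-SmoothPoincare4-CongruenceShadows)

The line's K-free TOP GATE ("at a maximal characteristic level `M` of `S = SurfaceGroup (3+3m)` with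
non-abelian quotient, every covering triple of normal overgroups of `M` pairwise `Aut S`-equivalent to the
standard shadow triple `(Nᵢ ⊔ M)ᵢ` is simultaneously equivalent to it") from the lattice form of
Dunfield–Thurston's alternating monodromy at FIXED genus: at every such level EITHER there are at least
`8` maximal normal overgroups of `M` and every 3-cycle of them is realised by an automorphism of `S`, OR
there are at most `2` of them. Sorry-free reduction = `helper_gateOfMonodromy` (Hall coordinates) applied
to `X = (Nᵢ ⊔ M)ᵢ`, which covers because the standard triple is a trisection of `{1}`
(`sup_eq_top_of_isGroupTrisection_punit`). The monodromy statement itself is the line's registered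
conjecture-grade stub `stub_topMonodromy`. The file declares theorems only.
-/

set_option linter.dupNamespace false

noncomputable section

namespace Summit.SmoothPoincare4.SmoothPoincare4.Theorems.ShadowsStandard.PrymLayerStableRank

open Literature.Topology.FourManifolds
open Subgroup

/-! ## The top-stratum gate of the line from alternating (3-cycle) monodromy -/

/-- **`TopGate` from monodromy** (line `prym-layer-stable-rank`): if at every maximal characteristic
level `M` of `S = SurfaceGroup (3+3m)` with non-abelian quotient EITHER there are at least `8` maximal
normal overgroups of `M` and every 3-cycle of them is realised by an automorphism of `S`
(Dunfield–Thurston alternating monodromy at FIXED genus, in lattice form) OR there are at most `2` of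
them (no `Aut S`-orbit on `Epi(S,T)/Aut T` of size `3 … 7`, as follows from the smallest-quotient and
minimal-index theorems for `Mod_g`, `g ≥ 3`), then the K-free TOP GATE of the line holds: every
covering triple of normal overgroups of `M` pairwise `Aut S`-equivalent to the standard shadow triple
`(Nᵢ ⊔ M)ᵢ` is simultaneously equivalent to it. [folklore] -/
theorem topGate_of_monodromy
    (hAlt : ∀ (m : ℕ) (M : Subgroup (SurfaceGroup (3 + 3 * m))), M.Characteristic → M.FiniteIndex →
      (∀ X : Subgroup (SurfaceGroup (3 + 3 * m)), X.Characteristic → M < X → X = ⊤) →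
      ¬ ⁅(⊤ : Subgroup (SurfaceGroup (3 + 3 * m))), (⊤ : Subgroup (SurfaceGroup (3 + 3 * m)))⁆ ≤ M →
      (8 ≤ {P : Subgroup (SurfaceGroup (3 + 3 * m)) | P.Normal ∧ M ≤ P ∧ P ≠ ⊤ ∧
            ∀ Q : Subgroup (SurfaceGroup (3 + 3 * m)), Q.Normal → P ≤ Q → Q = P ∨ Q = ⊤}.ncard ∧
        ∀ P₁ P₂ P₃ : Subgroup (SurfaceGroup (3 + 3 * m)),
          (P₁.Normal ∧ M ≤ P₁ ∧ P₁ ≠ ⊤ ∧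
            ∀ Q : Subgroup (SurfaceGroup (3 + 3 * m)), Q.Normal → P₁ ≤ Q → Q = P₁ ∨ Q = ⊤) →
          (P₂.Normal ∧ M ≤ P₂ ∧ P₂ ≠ ⊤ ∧
            ∀ Q : Subgroup (SurfaceGroup (3 + 3 * m)), Q.Normal → P₂ ≤ Q → Q = P₂ ∨ Q = ⊤) →
          (P₃.Normal ∧ M ≤ P₃ ∧ P₃ ≠ ⊤ ∧
            ∀ Q : Subgroup (SurfaceGroup (3 + 3 * m)), Q.Normal → P₃ ≤ Q → Q = P₃ ∨ Q = ⊤) →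
          P₁ ≠ P₂ → P₂ ≠ P₃ → P₁ ≠ P₃ →
          ∃ ψ : SurfaceGroup (3 + 3 * m) ≃* SurfaceGroup (3 + 3 * m),
            P₁.map ψ.toMonoidHom = P₂ ∧ P₂.map ψ.toMonoidHom = P₃ ∧ P₃.map ψ.toMonoidHom = P₁ ∧
            ∀ P : Subgroup (SurfaceGroup (3 + 3 * m)),
              (P.Normal ∧ M ≤ P ∧ P ≠ ⊤ ∧
                ∀ Q : Subgroup (SurfaceGroup (3 + 3 * m)), Q.Normal → P ≤ Q → Q = P ∨ Q = ⊤) →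
              P ≠ P₁ → P ≠ P₂ → P ≠ P₃ → P.map ψ.toMonoidHom = P) ∨
      {P : Subgroup (SurfaceGroup (3 + 3 * m)) | P.Normal ∧ M ≤ P ∧ P ≠ ⊤ ∧
          ∀ Q : Subgroup (SurfaceGroup (3 + 3 * m)), Q.Normal → P ≤ Q → Q = P ∨ Q = ⊤}.ncard ≤ 2) :
    ∀ (m : ℕ) (M : Subgroup (SurfaceGroup (3 + 3 * m))), M.Characteristic → M.FiniteIndex →
      (∀ X : Subgroup (SurfaceGroup (3 + 3 * m)), X.Characteristic → M < X → X = ⊤) →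
      ¬ ⁅(⊤ : Subgroup (SurfaceGroup (3 + 3 * m))), (⊤ : Subgroup (SurfaceGroup (3 + 3 * m)))⁆ ≤ M →
      ∀ Y : Fin 3 → Subgroup (SurfaceGroup (3 + 3 * m)), (∀ i, (Y i).Normal) → (∀ i, M ≤ Y i) →
      (∀ i j : Fin 3, i ≠ j → ∃ α : SurfaceGroup (3 + 3 * m) ≃* SurfaceGroup (3 + 3 * m),
        (s4Kernels.stabilizeIter m i ⊔ M).map α.toMonoidHom = Y i ∧
          (s4Kernels.stabilizeIter m j ⊔ M).map α.toMonoidHom = Y j) →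
      Y 0 ⊔ Y 1 ⊔ Y 2 = ⊤ →
      ∃ ψ : SurfaceGroup (3 + 3 * m) ≃* SurfaceGroup (3 + 3 * m), ∀ i : Fin 3,
        (s4Kernels.stabilizeIter m i ⊔ M).map ψ.toMonoidHom = Y i := by
  intro m M hM hMf hmaxc hnonab Y hYn hMY hpair hcov
  haveI : M.Characteristic := hM
  haveI hNn : ∀ i, (s4Kernels.stabilizeIter m i).Normal :=
    (Summit.SmoothPoincare4.SmoothPoincare4.Theorems.ShadowsStandard.Negative.stabilizeIter_isGroupTrisection
      m).normal
  have hXcov : (s4Kernels.stabilizeIter m 0 ⊔ M) ⊔ (s4Kernels.stabilizeIter m 1 ⊔ M) ⊔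
      (s4Kernels.stabilizeIter m 2 ⊔ M) = ⊤ := by
    have h := Summit.SmoothPoincare4.SmoothPoincare4.Theorems.HeegaardHandlebodyCongruenceClosed.PairRigidityRetraction.sup_eq_top_of_isGroupTrisection_punit
      (Summit.SmoothPoincare4.SmoothPoincare4.Theorems.ShadowsStandard.Negative.stabilizeIter_isGroupTrisection m)
    rw [eq_top_iff, ← h]
    exact sup_le (sup_le (le_sup_left.trans (le_sup_left.trans le_sup_left))
      (le_sup_left.trans (le_sup_right.trans le_sup_left))) (le_sup_left.trans le_sup_right)
  exact gate_of_monodromy M hM hMf hmaxc hnonab (hAlt m M hM hMf hmaxc hnonab)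
    (fun i => s4Kernels.stabilizeIter m i ⊔ M) Y (fun i => inferInstance) hYn
    (fun i => le_sup_right) hMY hpair hXcov hcov


/-- **REGISTERED HELPER `helper_topGateOfMonodromy`** (line `prym-layer-stable-rank`, lead c2, wave 2):
the K-free TOP GATE of the line from the 3-cycle/alternating monodromy statement (`∀`-form of
`topGate_of_monodromy`). [folklore] -/
theorem helper_topGateOfMonodromy :
    (∀ (m : ℕ) (M : Subgroup (SurfaceGroup (3 + 3 * m))), M.Characteristic → M.FiniteIndex →
      (∀ X : Subgroup (SurfaceGroup (3 + 3 * m)), X.Characteristic → M < X → X = ⊤) →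
      ¬ ⁅(⊤ : Subgroup (SurfaceGroup (3 + 3 * m))), (⊤ : Subgroup (SurfaceGroup (3 + 3 * m)))⁆ ≤ M →
      (8 ≤ {P : Subgroup (SurfaceGroup (3 + 3 * m)) | P.Normal ∧ M ≤ P ∧ P ≠ ⊤ ∧
            ∀ Q : Subgroup (SurfaceGroup (3 + 3 * m)), Q.Normal → P ≤ Q → Q = P ∨ Q = ⊤}.ncard ∧
        ∀ P₁ P₂ P₃ : Subgroup (SurfaceGroup (3 + 3 * m)),
          (P₁.Normal ∧ M ≤ P₁ ∧ P₁ ≠ ⊤ ∧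
            ∀ Q : Subgroup (SurfaceGroup (3 + 3 * m)), Q.Normal → P₁ ≤ Q → Q = P₁ ∨ Q = ⊤) →
          (P₂.Normal ∧ M ≤ P₂ ∧ P₂ ≠ ⊤ ∧
            ∀ Q : Subgroup (SurfaceGroup (3 + 3 * m)), Q.Normal → P₂ ≤ Q → Q = P₂ ∨ Q = ⊤) →
          (P₃.Normal ∧ M ≤ P₃ ∧ P₃ ≠ ⊤ ∧
            ∀ Q : Subgroup (SurfaceGroup (3 + 3 * m)), Q.Normal → P₃ ≤ Q → Q = P₃ ∨ Q = ⊤) →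
          P₁ ≠ P₂ → P₂ ≠ P₃ → P₁ ≠ P₃ →
          ∃ ψ : SurfaceGroup (3 + 3 * m) ≃* SurfaceGroup (3 + 3 * m),
            P₁.map ψ.toMonoidHom = P₂ ∧ P₂.map ψ.toMonoidHom = P₃ ∧ P₃.map ψ.toMonoidHom = P₁ ∧
            ∀ P : Subgroup (SurfaceGroup (3 + 3 * m)),
              (P.Normal ∧ M ≤ P ∧ P ≠ ⊤ ∧
                ∀ Q : Subgroup (SurfaceGroup (3 + 3 * m)), Q.Normal → P ≤ Q → Q = P ∨ Q = ⊤) →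
              P ≠ P₁ → P ≠ P₂ → P ≠ P₃ → P.map ψ.toMonoidHom = P) ∨
      {P : Subgroup (SurfaceGroup (3 + 3 * m)) | P.Normal ∧ M ≤ P ∧ P ≠ ⊤ ∧
          ∀ Q : Subgroup (SurfaceGroup (3 + 3 * m)), Q.Normal → P ≤ Q → Q = P ∨ Q = ⊤}.ncard ≤ 2) →
    ∀ (m : ℕ) (M : Subgroup (SurfaceGroup (3 + 3 * m))), M.Characteristic → M.FiniteIndex →
      (∀ X : Subgroup (SurfaceGroup (3 + 3 * m)), X.Characteristic → M < X → X = ⊤) →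
      ¬ ⁅(⊤ : Subgroup (SurfaceGroup (3 + 3 * m))), (⊤ : Subgroup (SurfaceGroup (3 + 3 * m)))⁆ ≤ M →
      ∀ Y : Fin 3 → Subgroup (SurfaceGroup (3 + 3 * m)), (∀ i, (Y i).Normal) → (∀ i, M ≤ Y i) →
      (∀ i j : Fin 3, i ≠ j → ∃ α : SurfaceGroup (3 + 3 * m) ≃* SurfaceGroup (3 + 3 * m),
        (s4Kernels.stabilizeIter m i ⊔ M).map α.toMonoidHom = Y i ∧
          (s4Kernels.stabilizeIter m j ⊔ M).map α.toMonoidHom = Y j) →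
      Y 0 ⊔ Y 1 ⊔ Y 2 = ⊤ →
      ∃ ψ : SurfaceGroup (3 + 3 * m) ≃* SurfaceGroup (3 + 3 * m), ∀ i : Fin 3,
        (s4Kernels.stabilizeIter m i ⊔ M).map ψ.toMonoidHom = Y i :=
  fun hAlt => topGate_of_monodromy hAlt

end Summit.SmoothPoincare4.SmoothPoincare4.Theorems.ShadowsStandard.PrymLayerStableRank

end
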